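import Mathlib
import HarnessLib

/-!
# Crux stmt-QuantumFields-19936 `HistoryTailL` — S-ALIGN brick E4: MULTILINEAR INTERPOLATION WEIGHTS ON A LATTICE CELL
# (the smoothing that spreads a coarse-link deviation `X` as `X∕L` per fine link in EVERY direction)

Cell `ym3-torus` (rung R3 = YM₃ on T³ — a RUNG, NOT the Clay problem), width seat `ym-ust-19936-w3` gen 12, `--supports stmt-QuantumFields-19936 --as helper`.
Summons w2 g11 02:42:44Z «w3 g12: S-ALIGN»: the hierarchical chart with GEOMETRIC DECAY `r = 2∕L` below the top needs, inside each coarse cell of side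
`L`, a fine site function interpolating `2^d` corner values `Λ ε` (`ε ∈ {0,1}^d`) whose increment along ONE fine step in direction `μ` is `1∕L` times a
CONVEX COMBINATION of the `μ`-edge differences `Λ(ε[μ ↦ 1]) − Λ(ε)` — so it is bounded by `max_ε ‖Λ(ε[μ↦1]) − Λ(ε)‖ ∕ L` in ANY norm, with no factor `d`
(the `d`-linear interpolation; a one-directional ramp would load the transverse bonds with the full deviation).  THIS FILE is that real-variable
bookkeeping, def-free (the weights are written out: `∏ k, (if ε k then t_k∕L else 1 − t_k∕L)`), for any real normed space `E`:
`sum_weights_eq_one`, `weights_nonneg`, ★`interp_succ_sub_interp` (the increment identity), ★★`norm_interp_succ_sub_interp_le` (the `M∕L` bound),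
`interp_corner` (at the corners the interpolant is the corner value).
-/

open scoped BigOperators

namespace Summit.QuantumFields.YangMills.Theorems.PoincareLipschitzHierAlignMultilinear

variable {d : ℕ} {E : Type*} [NormedAddCommGroup E] [NormedSpace ℝ E]

/-- One coordinate's pair of weights sums to one: `t∕L + (1 − t∕L) = 1`. [folklore] -/
theorem weight_true_add_false (L t : ℕ) :
    (if true then ((t : ℝ) / L) else (1 - (t : ℝ) / L)) + (if false then ((t : ℝ) / L) else (1 - (t : ℝ) / L)) = 1 := by
  simp

/-- **THE WEIGHTS SUM TO ONE**: `Σ_{ε ∈ {0,1}^d} ∏_k w_k(ε_k) = ∏_k (w_k(1) + w_k(0)) = 1`. [folklore] -/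
theorem sum_weights_eq_one (L : ℕ) (t : Fin d → ℕ) :
    ∑ ε : Fin d → Bool, ∏ k, (if ε k then ((t k : ℝ) / L) else (1 - (t k : ℝ) / L)) = 1 := by
  have h := Finset.prod_univ_sum (fun (_ : Fin d) => (Finset.univ : Finset Bool))
    (fun (k : Fin d) (b : Bool) => (if b then ((t k : ℝ) / L) else (1 - (t k : ℝ) / L)))
  rw [Fintype.piFinset_univ] at h
  rw [← h]
  refine Finset.prod_eq_one fun k _ => ?_
  simp

/-- The weights are nonnegative on the cell `0 ≤ t_k ≤ L`. [folklore] -/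
theorem weights_nonneg {L : ℕ} {t : Fin d → ℕ} (ht : ∀ k, t k ≤ L) (ε : Fin d → Bool) :
    0 ≤ ∏ k, (if ε k then ((t k : ℝ) / L) else (1 - (t k : ℝ) / L)) := by
  refine Finset.prod_nonneg fun k _ => ?_
  rcases Nat.eq_zero_or_pos L with hL | hL
  · subst hL; have h0 : t k = 0 := by have := ht k; omega
    rcases Bool.eq_false_or_eq_true (ε k) with hb | hb <;> simp [hb, h0]
  have hL' : (0 : ℝ) < L := by exact_mod_cast hL
  have htk : (t k : ℝ) ≤ L := by exact_mod_cast ht k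
  split_ifs
  · positivity
  · rw [sub_nonneg, div_le_one hL']; exact htk

/-- One step in direction `μ` changes only the `μ`-th weight, by `±1∕L`: the weight of `ε` at `t + e_μ` minus at `t` is
`(∏_{k≠μ} w_k) · (if ε_μ then 1∕L else −1∕L)`. [folklore] -/
theorem weight_succ_sub_weight (L : ℕ) (t : Fin d → ℕ) (μ : Fin d) (ε : Fin d → Bool) :
    (∏ k, (if ε k then (((Function.update t μ (t μ + 1) k : ℕ) : ℝ) / L) else (1 - ((Function.update t μ (t μ + 1) k : ℕ) : ℝ) / L))) -
      ∏ k, (if ε k then ((t k : ℝ) / L) else (1 - (t k : ℝ) / L)) =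
      (∏ k ∈ Finset.univ.erase μ, (if ε k then ((t k : ℝ) / L) else (1 - (t k : ℝ) / L))) *
        (if ε μ then (1 : ℝ) / L else -(1 : ℝ) / L) := by
  rw [← Finset.mul_prod_erase Finset.univ _ (Finset.mem_univ μ), ← Finset.mul_prod_erase Finset.univ _ (Finset.mem_univ μ)]
  have hrest : ∏ k ∈ Finset.univ.erase μ,
      (if ε k then (((Function.update t μ (t μ + 1) k : ℕ) : ℝ) / L) else (1 - ((Function.update t μ (t μ + 1) k : ℕ) : ℝ) / L)) =
      ∏ k ∈ Finset.univ.erase μ, (if ε k then ((t k : ℝ) / L) else (1 - (t k : ℝ) / L)) := by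
    refine Finset.prod_congr rfl fun k hk => ?_
    rw [Function.update_of_ne (Finset.ne_of_mem_erase hk)]
  rw [hrest, Function.update_self]
  push_cast
  split_ifs <;> ring

/-- ★ **THE INCREMENT IDENTITY.**  The multilinear interpolant `I(t) = Σ_ε (∏_k w_k(t,ε)) • Λ ε` satisfies
`I(t + e_μ) − I(t) = (1∕L) • Σ_{ε : ε_μ = 0} (∏_{k≠μ} w_k(t,ε)) • (Λ(ε[μ↦1]) − Λ ε)`. [folklore] -/
theorem interp_succ_sub_interp (L : ℕ) (t : Fin d → ℕ) (μ : Fin d) (Λ : (Fin d → Bool) → E) :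
    (∑ ε : Fin d → Bool, (∏ k, (if ε k then (((Function.update t μ (t μ + 1) k : ℕ) : ℝ) / L)
        else (1 - ((Function.update t μ (t μ + 1) k : ℕ) : ℝ) / L))) • Λ ε) -
      ∑ ε : Fin d → Bool, (∏ k, (if ε k then ((t k : ℝ) / L) else (1 - (t k : ℝ) / L))) • Λ ε =
      ((1 : ℝ) / L) • ∑ ε ∈ Finset.univ.filter (fun ε : Fin d → Bool => ε μ = false),
        (∏ k ∈ Finset.univ.erase μ, (if ε k then ((t k : ℝ) / L) else (1 - (t k : ℝ) / L))) •
          (Λ (Function.update ε μ true) - Λ ε) := by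
  rw [← Finset.sum_sub_distrib]
  simp_rw [← sub_smul, weight_succ_sub_weight]
  -- split the sum over `ε μ`
  rw [← Finset.sum_filter_add_sum_filter_not Finset.univ (fun ε : Fin d → Bool => ε μ = false)]
  -- the `ε μ = true` part, re-indexed by `ε ↦ update ε μ true` from the `false` part
  have hbij : ∑ ε ∈ Finset.univ.filter (fun ε : Fin d → Bool => ¬ ε μ = false),
      ((∏ k ∈ Finset.univ.erase μ, (if ε k then ((t k : ℝ) / L) else (1 - (t k : ℝ) / L))) *
        (if ε μ then (1 : ℝ) / L else -(1 : ℝ) / L)) • Λ ε =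
      ∑ ε ∈ Finset.univ.filter (fun ε : Fin d → Bool => ε μ = false),
        ((∏ k ∈ Finset.univ.erase μ, (if ε k then ((t k : ℝ) / L) else (1 - (t k : ℝ) / L))) * ((1 : ℝ) / L)) •
          Λ (Function.update ε μ true) := by
    refine Finset.sum_bij' (fun ε _ => Function.update ε μ false) (fun ε _ => Function.update ε μ true) ?_ ?_ ?_ ?_ ?_
    · intro ε _; simp
    · intro ε _; simp
    · intro ε hε
      simp only [Finset.mem_filter, Finset.mem_univ, true_and, Bool.not_eq_false] at hε
      funext k; by_cases hk : k = μ
      · subst hk; simp [hε]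
      · simp [Function.update_of_ne hk]
    · intro ε hε
      simp only [Finset.mem_filter, Finset.mem_univ, true_and] at hε
      funext k; by_cases hk : k = μ
      · subst hk; simp [hε]
      · simp [Function.update_of_ne hk]
    · intro ε hε
      simp only [Finset.mem_filter, Finset.mem_univ, true_and, Bool.not_eq_false] at hε
      have hw : ∏ k ∈ Finset.univ.erase μ, (if Function.update ε μ false k then ((t k : ℝ) / L) else (1 - (t k : ℝ) / L)) =
          ∏ k ∈ Finset.univ.erase μ, (if ε k then ((t k : ℝ) / L) else (1 - (t k : ℝ) / L)) :=
        Finset.prod_congr rfl fun k hk => by rw [Function.update_of_ne (Finset.ne_of_mem_erase hk)]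
      have hε' : Function.update (Function.update ε μ false) μ true = ε := by
        funext k; by_cases hk : k = μ
        · subst hk; simp [hε]
        · simp [Function.update_of_ne hk]
      rw [hw, hε', hε]
      simp
  rw [add_comm, hbij, ← Finset.sum_add_distrib, Finset.smul_sum]
  refine Finset.sum_congr rfl fun ε hε => ?_
  simp only [Finset.mem_filter, Finset.mem_univ, true_and] at hε
  set w : ℝ := ∏ k ∈ Finset.univ.erase μ, (if ε k then ((t k : ℝ) / L) else (1 - (t k : ℝ) / L)) with hw
  simp only [hε, Bool.false_eq_true, ↓reduceIte]
  module

/-- The transverse weights over `{ε : ε_μ = 0}` also sum to one. [folklore] -/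
theorem sum_transverse_weights_eq_one (L : ℕ) (t : Fin d → ℕ) (μ : Fin d) :
    ∑ ε ∈ Finset.univ.filter (fun ε : Fin d → Bool => ε μ = false),
      ∏ k ∈ Finset.univ.erase μ, (if ε k then ((t k : ℝ) / L) else (1 - (t k : ℝ) / L)) = 1 := by
  -- insert the factor `w_μ(false) + w_μ(true) = 1` and undo the split of `sum_weights_eq_one`
  have h1 := sum_weights_eq_one L t
  rw [← Finset.sum_filter_add_sum_filter_not Finset.univ (fun ε : Fin d → Bool => ε μ = false)] at h1
  have hA : ∑ ε ∈ Finset.univ.filter (fun ε : Fin d → Bool => ε μ = false),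
      ∏ k, (if ε k then ((t k : ℝ) / L) else (1 - (t k : ℝ) / L)) =
      ∑ ε ∈ Finset.univ.filter (fun ε : Fin d → Bool => ε μ = false),
        (1 - (t μ : ℝ) / L) * ∏ k ∈ Finset.univ.erase μ, (if ε k then ((t k : ℝ) / L) else (1 - (t k : ℝ) / L)) := by
    refine Finset.sum_congr rfl fun ε hε => ?_
    simp only [Finset.mem_filter, Finset.mem_univ, true_and] at hε
    rw [← Finset.mul_prod_erase Finset.univ _ (Finset.mem_univ μ), hε]
    simp
  have hB : ∑ ε ∈ Finset.univ.filter (fun ε : Fin d → Bool => ¬ ε μ = false),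
      ∏ k, (if ε k then ((t k : ℝ) / L) else (1 - (t k : ℝ) / L)) =
      ∑ ε ∈ Finset.univ.filter (fun ε : Fin d → Bool => ε μ = false),
        ((t μ : ℝ) / L) * ∏ k ∈ Finset.univ.erase μ, (if ε k then ((t k : ℝ) / L) else (1 - (t k : ℝ) / L)) := by
    refine (Finset.sum_bij' (fun ε _ => Function.update ε μ false) (fun ε _ => Function.update ε μ true) ?_ ?_ ?_ ?_ ?_)
      <;> intro ε hε
    · simp
    · simp only [Finset.mem_filter, Finset.mem_univ, true_and] at hε ⊢; simp
    · simp only [Finset.mem_filter, Finset.mem_univ, true_and, Bool.not_eq_false] at hε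
      funext k; by_cases hk : k = μ
      · subst hk; simp [hε]
      · simp [Function.update_of_ne hk]
    · simp only [Finset.mem_filter, Finset.mem_univ, true_and] at hε
      funext k; by_cases hk : k = μ
      · subst hk; simp [hε]
      · simp [Function.update_of_ne hk]
    · simp only [Finset.mem_filter, Finset.mem_univ, true_and, Bool.not_eq_false] at hε
      rw [← Finset.mul_prod_erase Finset.univ _ (Finset.mem_univ μ), hε]
      simp only [↓reduceIte]
      congr 1
      exact Finset.prod_congr rfl fun k hk => by rw [Function.update_of_ne (Finset.ne_of_mem_erase hk)]
  rw [hA, hB, ← Finset.sum_add_distrib] at h1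
  simp_rw [← add_mul] at h1
  rw [← Finset.mul_sum] at h1
  have : (1 - (t μ : ℝ) / L) + (t μ : ℝ) / L = 1 := by ring
  rw [this, one_mul] at h1
  exact h1

/-- ★★ **THE `M∕L` BOUND**: on the cell (`t_k ≤ L`), if every `μ`-edge difference of the corner data is `≤ M` in norm, then one fine step in
direction `μ` changes the multilinear interpolant by at most `M∕L` — in ANY norm, with no dimension factor. [folklore] -/
theorem norm_interp_succ_sub_interp_le {L : ℕ} (hL : 0 < L) {t : Fin d → ℕ} (ht : ∀ k, t k ≤ L) (μ : Fin d)
    (Λ : (Fin d → Bool) → E) {M : ℝ} (hM : ∀ ε : Fin d → Bool, ε μ = false → ‖Λ (Function.update ε μ true) - Λ ε‖ ≤ M) :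
    ‖(∑ ε : Fin d → Bool, (∏ k, (if ε k then (((Function.update t μ (t μ + 1) k : ℕ) : ℝ) / L)
        else (1 - ((Function.update t μ (t μ + 1) k : ℕ) : ℝ) / L))) • Λ ε) -
      ∑ ε : Fin d → Bool, (∏ k, (if ε k then ((t k : ℝ) / L) else (1 - (t k : ℝ) / L))) • Λ ε‖ ≤ M / L := by
  rw [interp_succ_sub_interp]
  have hL' : (0 : ℝ) < L := by exact_mod_cast hL
  have hM0 : 0 ≤ M := by
    have := hM (fun _ => false) rfl; exact (norm_nonneg _).trans this
  rw [norm_smul, Real.norm_eq_abs, abs_of_pos (by positivity : (0 : ℝ) < 1 / L)]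
  have hw0 : ∀ ε : Fin d → Bool, 0 ≤ ∏ k ∈ Finset.univ.erase μ, (if ε k then ((t k : ℝ) / L) else (1 - (t k : ℝ) / L)) := by
    intro ε
    refine Finset.prod_nonneg fun k _ => ?_
    have htk : (t k : ℝ) ≤ L := by exact_mod_cast ht k
    split_ifs
    · positivity
    · rw [sub_nonneg, div_le_one hL']; exact htk
  calc (1 : ℝ) / L * ‖∑ ε ∈ Finset.univ.filter (fun ε : Fin d → Bool => ε μ = false),
          (∏ k ∈ Finset.univ.erase μ, (if ε k then ((t k : ℝ) / L) else (1 - (t k : ℝ) / L))) • (Λ (Function.update ε μ true) - Λ ε)‖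
      ≤ (1 : ℝ) / L * ∑ ε ∈ Finset.univ.filter (fun ε : Fin d → Bool => ε μ = false),
          (∏ k ∈ Finset.univ.erase μ, (if ε k then ((t k : ℝ) / L) else (1 - (t k : ℝ) / L))) * M := by
        refine mul_le_mul_of_nonneg_left ((norm_sum_le _ _).trans (Finset.sum_le_sum fun ε hε => ?_)) (by positivity)
        simp only [Finset.mem_filter, Finset.mem_univ, true_and] at hε
        rw [norm_smul, Real.norm_eq_abs, abs_of_nonneg (hw0 ε)]
        exact mul_le_mul_of_nonneg_left (hM ε hε) (hw0 ε)
    _ = M / L := by rw [← Finset.sum_mul, sum_transverse_weights_eq_one]; ring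

/-- **AT A CORNER THE INTERPOLANT IS THE CORNER VALUE**: if every `t_k ∈ {0, L}` (`L > 0`) then `I(t) = Λ(ε(t))`, `ε(t)_k = [t_k = L]`. [folklore] -/
theorem interp_corner {L : ℕ} (hL : 0 < L) {t : Fin d → ℕ} (ht : ∀ k, t k = 0 ∨ t k = L) (Λ : (Fin d → Bool) → E) :
    ∑ ε : Fin d → Bool, (∏ k, (if ε k then ((t k : ℝ) / L) else (1 - (t k : ℝ) / L))) • Λ ε =
      Λ (fun k => decide (t k = L)) := by
  have hL' : (L : ℝ) ≠ 0 := by exact_mod_cast hL.ne'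
  rw [Finset.sum_eq_single (fun k => decide (t k = L))]
  · have : ∏ k, (if (fun k => decide (t k = L)) k then ((t k : ℝ) / L) else (1 - (t k : ℝ) / L)) = 1 := by
      refine Finset.prod_eq_one fun k _ => ?_
      rcases ht k with h | h
      · have hne : ¬ ((0 : ℕ) = L) := by omega
        simp [h, hne]
      · simp [h, hL']
    rw [this, one_smul]
  · intro ε _ hne
    -- some coordinate disagrees with the corner: its weight vanishes
    obtain ⟨k, hk⟩ : ∃ k, ε k ≠ decide (t k = L) := by
      by_contra hall; push Not at hall; exact hne (funext hall)
    have hzero : (if ε k then ((t k : ℝ) / L) else (1 - (t k : ℝ) / L)) = 0 := by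
      rcases ht k with h | h
      · have : ε k = true := by
          cases hεk : ε k
          · exfalso; apply hk; rw [hεk]; have hne : ¬ ((0 : ℕ) = L) := by omega
            simp [h, hne]
          · rfl
        simp [this, h]
      · have : ε k = false := by
          cases hεk : ε k
          · rfl
          · exfalso; apply hk; rw [hεk]; simp [h]
        simp [this, h, hL']
    rw [Finset.prod_eq_zero (Finset.mem_univ k) hzero, zero_smul]
  · intro h; exact absurd (Finset.mem_univ _) h

end Summit.QuantumFields.YangMills.Theorems.PoincareLipschitzHierAlignMultilinear
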